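import Summits.BirchSwinnertonDyer.BirchSwinnertonDyer.Theorems.ResidualThetaTransportAtTwoResidualSignedLambdaLowerCMAtTwoLocalBlockCount
import Summits.BirchSwinnertonDyer.BirchSwinnertonDyer.Theorems.UniversalToricDescentLocalH1Divisible
import Summits.BirchSwinnertonDyer.BirchSwinnertonDyer.Theorems.ResidualThetaTransportAtTwoResidualSignedLambdaLowerCMAtTwoCofreeTorsionFinite
import Summits.BirchSwinnertonDyer.BirchSwinnertonDyer.Theorems.ResidualThetaTransportAtTwoResidualSignedLambdaLowerCMAtTwoCofreeTorsionCount
import Literature.NumberTheory.EllipticCurves.CofreeFrobeniusRigidity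
import Literature.NumberTheory.EllipticCurves.Greenberg1999.LocalH1DivisibleCyclotomicProofs
import HarnessLib

/-!
# The GOOD-PLACE LOCAL BLOCK of RSL_g's one-pair count, sequel: the CM partner's cofree module `A_ρ = Cofree (ρ.toLocal v) F` at `p = 2` —
# EVEN trace ⟹ `#H¹(ℚ_{∞,w}, A_ρ)[2^k] = #A_ρ[2^k] = #(𝒪/2^k)²`, ODD trace ⟹ `H¹(ℚ_{∞,w}, A_ρ) = 0`

Route `ResidualThetaTransportAtTwo` (RTT), crux RSL_g `ResidualSignedLambdaLowerCMAtTwo` (stmt-BirchSwinnertonDyer-22608); width seat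
`prover-bsd-wall-tp2-p2x-w3` g16 (`--supports 22608 --as helper`, closes nothing). THEOREMS ONLY (no definition, no named fact, no instance, no notation,
no `sorry`). Stub plan rev 20 §3 item 5 (split stub S1⊕ `stub_localDualAwayTwo`, COUNT + FIN at the good places of `S₀`). The companion file
`…LocalBlockCount.lean` proves Greenberg–Vatsal's Prop. (2.4) in corank form for an ABSTRACT discrete `Γ_{K_v}`-module; here: `K = ℚ`, `p = 2`,
`A_ρ = Cofree (ρ.toLocal v) F` for `ρ : Γ_ℚ → GL₂(𝒪)` (`𝒪 = padicCoeffIntegers S`; `ρ.toLocal v` = restriction along `Γ_{ℚ_v} → Γ_ℚ` for the chosen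
embedding, so `Hi = localSubgroup (ker κ) ℚ_v = localSubgroupOfEmb (ker κ) (closureEmb ℚ_v)` acts through `ρ`), `v ∤ 2` not split completely in `κ`
(automatic for the cyclotomic `κ`: `exists_not_mem_localSubgroup_of_isCyclotomic`), local inertia trivial through `ρ` (`hI`), `φ` a local Frobenius
(`IsFrobPow φ 1`) with `det ρ(φ) ≡ 1 (mod ϖ)`; the only arithmetic input is `Literature/…/CofreeFrobeniusRigidity.lean` (w3 g15):

* EVEN trace `tr ρ(φ) ∈ (ϖ)` (‖ι a_ℓ‖ < 1): `Hi` acts TRIVIALLY on `A_ρ` (`forall_smul_cofree_eq_of_trace_mem`) and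
  **`#H¹(Hi, A_ρ)[2^k] = #A_ρ[2^k] = #(𝒪/2^k 𝒪)²`** for every `k` (`natCard_torsionBy_subgroupH1_cofree_eq_of_trace_mem`, `…_eq_pow_of_trace_mem`):
  the block is `(F/𝒪)² ≅ (ℚ₂/ℤ₂)^{2f}` numerically (the `2` of RSL_g's summand `2^{n_ℓ}·2`);
* ODD trace `tr ρ(φ) ∉ (ϖ)`: **`H¹(Hi, A_ρ) = 0`** (`subgroupH1_cofree_eq_zero_of_trace_not_mem`) — summand `0`;
* any trace: `H¹(Hi, A_ρ)` is `2`-divisible (`exists_two_nsmul_eq_subgroupH1_cofree`, UTD's `exists_nsmul_eq_subgroupH1_localSubgroup`).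

The sequel `…LocalBlockCountFrobenius.lean` reads `hI`/`hdet`/`htr` off RSL_g's `ρ.IsUnramifiedAt v ∧ ρ.HasFrobCharpolyAt v (X² − a X + q)` and gives
`corank_{ℤ₂} = f·(if ‖a‖ < 1 then 2 else 0)`; the `2^{n_ℓ}` conjugate blocks and the value pins are the split frame's. BSD is not proved by any of this;
RSL_g (22608) is not proved here.

References: [GreenbergVatsal2000] §2 Prop. (2.4) and proof (arXiv p. 22); [GreenbergLNM1716] §3 Lemma 3.3; [SerreInventiones1972] §1.8 Prop. 6;
[EmertonPollackWeston2006] §3.1; [NeukirchANT1999] Ch. II (4.8); [Kato2004Asterisque] §13.8.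
-/

set_option autoImplicit false
-- the Theorems namespace of this sub repeats the summit name by design (D-0017 nested layout)
set_option linter.dupNamespace false

noncomputable section

open scoped Classical

namespace Summit.BirchSwinnertonDyer.BirchSwinnertonDyer.Theorems.ThetaTransport.LocalBlockCount

open NumberField IsDedekindDomain Field
open Literature.NumberTheory.EllipticCurves Literature.NumberTheory.GaloisRepresentations
  Literature.NumberTheory.GaloisRepresentations.IsNonarchimedeanLocalField
  Literature.NumberTheory.EllipticCurves.GreenbergSelmer IsDedekindDomain.HeightOneSpectrum
  Summit.BirchSwinnertonDyer.BirchSwinnertonDyer.Theorems.UniversalToricDescentLocalH1Divisible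

/-! ## §3 The cofree block `A_ρ = Cofree (ρ.toLocal v) F` at `p = 2`: EVEN trace ⟹ `#H¹(Hi, A_ρ)[2^k] = #A_ρ[2^k]`; ODD trace ⟹ `H¹(Hi, A_ρ) = 0` -/

section Cofree

variable (S : Set (PadicAlgCl 2)) [FiniteDimensional ℚ_[2] (padicCoeffField S)]
  (ρ : FramedGaloisRep ℚ (padicCoeffIntegers S) 2) (κ : ZpExtension ℚ 2) {v : HeightOneSpectrum (𝓞 ℚ)}

omit [FiniteDimensional ℚ_[2] (padicCoeffField S)] in
/-- `A_ρ = F²/𝒪²` is `2`-divisible (`x mod 𝒪² = 2 • (2⁻¹x mod 𝒪²)`). [cite: EmertonPollackWeston2006, §3.1] -/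
theorem exists_two_nsmul_eq_cofree (a : Cofree (ρ.toLocal v) (padicCoeffField S)) :
    ∃ b : Cofree (ρ.toLocal v) (padicCoeffField S), 2 • b = a := by
  obtain ⟨x, rfl⟩ := cofreeMk_surjective (padicCoeffField S) (ρ.toLocal v) a
  refine ⟨cofreeMk (padicCoeffField S) (ρ.toLocal v) ((2 : padicCoeffField S)⁻¹ • x), ?_⟩
  rw [← map_nsmul, ← Nat.cast_smul_eq_nsmul (padicCoeffField S), smul_smul, Nat.cast_ofNat, mul_inv_cancel₀ two_ne_zero, one_smul]

omit [FiniteDimensional ℚ_[2] (padicCoeffField S)] in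
/-- The orbit maps of `Γ_{ℚ_v}` on `A_ρ` are continuous (open stabilisers, `isOpen_stabilizer_cofree`). [cite: EmertonPollackWeston2006, §3.1] -/
theorem continuous_smul_cofree (a : Cofree (ρ.toLocal v) (padicCoeffField S)) :
    Continuous fun g : absoluteGaloisGroup (v.adicCompletion ℚ) ↦ g • a :=
  Summit.BirchSwinnertonDyer.BirchSwinnertonDyer.Theorems.SignedTransportAtTwo.continuous_smul_const_of_isOpen_stabilizer a
    (isOpen_stabilizer_cofree S (ρ.toLocal v) a)

omit [FiniteDimensional ℚ_[2] (padicCoeffField S)] in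
/-- An element of `Γ_{ℚ_v}` on which `ρ` is trivial acts trivially on `A_ρ` (e.g. local inertia at an unramified place). [folklore] -/
theorem smul_cofree_eq_of_apply_eq_one {σ : absoluteGaloisGroup (v.adicCompletion ℚ)} (hσ : ρ (absGaloisRestrict ℚ (v.adicCompletion ℚ) σ) = 1)
    (a : Cofree (ρ.toLocal v) (padicCoeffField S)) : σ • a = a := by
  obtain ⟨x, rfl⟩ := cofreeMk_surjective (padicCoeffField S) (ρ.toLocal v) a
  have h1 : (ρ.toLocal v) σ = 1 := hσ
  rw [smul_cofreeMk, fracRepresentation_apply_apply, h1, Units.val_one, Matrix.map_one _ (map_zero _) (map_one _), Matrix.one_mulVec]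

/-- `q_v = #k(ℚ_v)` is ODD at a place `v ∤ 2` (a power of the residue characteristic `≠ 2`). [folklore] -/
theorem odd_residueFieldCard (h2v : ((2 : ℕ) : 𝓞 ℚ) ∉ v.asIdeal) : Odd (residueFieldCard (v.adicCompletion ℚ)) := by
  obtain ⟨f, -, hf⟩ := residueFieldCard_eq_pow_ringChar (F := v.adicCompletion ℚ)
  rw [hf]
  exact ((ringChar_residueField_prime (F := v.adicCompletion ℚ)).odd_of_ne_two (v.ringChar_residueField_adicCompletion_ne h2v)).pow

/-- For a uniformiser `ϖ` of `𝒪`: `2 ∈ (ϖ)`, and `2^k • a = 0 ⟹ ϖ^{e k} • a = 0` on any `𝒪`-module, where `(ϖ)^e ⊆ (2)`. [cite: NeukirchANT1999, Ch. II (4.8)] -/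
theorem exists_two_mem_span_and_pow_smul_eq_zero {ϖ : padicCoeffIntegers S} (hϖ : Irreducible ϖ) :
    (2 : padicCoeffIntegers S) ∈ Ideal.span {ϖ} ∧ ∃ e : ℕ, ∀ {M : Type} [AddCommGroup M] [Module (padicCoeffIntegers S) M]
      (k : ℕ) (a : M), 2 ^ k • a = 0 → ϖ ^ (e * k) • a = 0 := by
  obtain ⟨e, -, hpow, hle⟩ := Summit.BirchSwinnertonDyer.BirchSwinnertonDyer.Theorems.LambdaLowerBoundO.exists_span_pow_le_span_natCast_prime S hϖ
  refine ⟨by simpa only [Nat.cast_ofNat] using (Ideal.span_singleton_le_iff_mem _).mp hle, e, fun k a ha ↦ ?_⟩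
  rw [Ideal.span_singleton_pow, Ideal.span_singleton_le_iff_mem, Ideal.mem_span_singleton'] at hpow
  obtain ⟨c, hc⟩ := hpow
  rw [pow_mul, ← hc, mul_pow, mul_smul, ← Nat.cast_pow, Nat.cast_smul_eq_nsmul, ha, smul_zero]

/-- **EVEN trace ⟹ `Gal(ℚ̄_ℓ/ℚ_{∞,w})` acts TRIVIALLY on `A_ρ`.** Setting: `v ∤ 2` not split completely in the `ℤ₂`-extension `κ`, `ρ : Γ_ℚ → GL₂(𝒪)`
with local inertia at `v` acting trivially, `φ` an arithmetic Frobenius of `ℚ_v` with `det ρ(φ) ≡ 1` and `tr ρ(φ) ≡ 0 (mod ϖ)`. By `CofreeFrobeniusRigidity`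
(`ρ(φ)^{2^R} ≡ 1 mod ϖ^R`) the `2`-power Frobenii fix every layer `A_ρ[2^k]`, so §2 applies. [cite: GreenbergVatsal2000, §2 Prop. (2.4)]
[cite: SerreInventiones1972, §1.8 Prop. 6] -/
theorem forall_smul_cofree_eq_of_trace_mem (h2v : ((2 : ℕ) : 𝓞 ℚ) ∉ v.asIdeal)
    (hns : ∃ σ : absoluteGaloisGroup (v.adicCompletion ℚ), σ ∉ localSubgroup κ.kerSubgroup (v.adicCompletion ℚ))
    {φ : absoluteGaloisGroup (v.adicCompletion ℚ)} (hφ : IsFrobPow φ 1)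
    (hI : ∀ σ ∈ absInertia (v.adicCompletion ℚ), ρ (absGaloisRestrict ℚ (v.adicCompletion ℚ) σ) = 1)
    {ϖ : padicCoeffIntegers S} (hϖ : Irreducible ϖ)
    (hdet : ((ρ (absGaloisRestrict ℚ (v.adicCompletion ℚ) φ) : GL (Fin 2) (padicCoeffIntegers S)) : Matrix (Fin 2) (Fin 2) (padicCoeffIntegers S)).det - 1 ∈ Ideal.span {ϖ})
    (htr : ((ρ (absGaloisRestrict ℚ (v.adicCompletion ℚ) φ) : GL (Fin 2) (padicCoeffIntegers S)) : Matrix (Fin 2) (Fin 2) (padicCoeffIntegers S)).trace ∈ Ideal.span {ϖ}) :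
    ∀ h ∈ localSubgroup κ.kerSubgroup (v.adicCompletion ℚ), ∀ a : Cofree (ρ.toLocal v) (padicCoeffField S), h • a = a := by
  obtain ⟨h2, e, hpow⟩ := exists_two_mem_span_and_pow_smul_eq_zero S hϖ
  refine forall_smul_eq_of_frob_pow_fix κ h2v hns hφ (exists_pow_smul_cofree_eq_zero S (ρ.toLocal v))
    (fun k ↦ Summit.BirchSwinnertonDyer.BirchSwinnertonDyer.Theorems.LambdaLowerBoundO.finite_torsionBy_cofree_pow S ρ k)
    (continuous_smul_cofree S ρ) (fun σ hσ ↦ smul_cofree_eq_of_apply_eq_one S ρ (hI σ hσ)) fun k ↦ ⟨e * k, fun R hR a ha ↦ ?_⟩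
  exact Cofree.pow_two_pow_smul_eq_self (padicCoeffField S) (ρ.toLocal v) ϖ h2 φ hdet htr (e * k) R hR a (hpow k a ha)

/-- **EVEN trace ⟹ `#H¹(ℚ_{∞,w}, A_ρ)[2^k] = #A_ρ[2^k]` for every `k`** (Greenberg–Vatsal Prop. (2.4) for the CM partner's cofree module at a good
place of even trace: the local block is the whole coefficient module, corank `2f`). [cite: GreenbergVatsal2000, §2 Prop. (2.4) and proof (arXiv p. 22)]
[cite: GreenbergLNM1716, §3 Lemma 3.3] -/
theorem natCard_torsionBy_subgroupH1_cofree_eq_of_trace_mem (h2v : ((2 : ℕ) : 𝓞 ℚ) ∉ v.asIdeal)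
    (hns : ∃ σ : absoluteGaloisGroup (v.adicCompletion ℚ), σ ∉ localSubgroup κ.kerSubgroup (v.adicCompletion ℚ))
    {φ : absoluteGaloisGroup (v.adicCompletion ℚ)} (hφ : IsFrobPow φ 1)
    (hI : ∀ σ ∈ absInertia (v.adicCompletion ℚ), ρ (absGaloisRestrict ℚ (v.adicCompletion ℚ) σ) = 1)
    {ϖ : padicCoeffIntegers S} (hϖ : Irreducible ϖ)
    (hdet : ((ρ (absGaloisRestrict ℚ (v.adicCompletion ℚ) φ) : GL (Fin 2) (padicCoeffIntegers S)) : Matrix (Fin 2) (Fin 2) (padicCoeffIntegers S)).det - 1 ∈ Ideal.span {ϖ})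
    (htr : ((ρ (absGaloisRestrict ℚ (v.adicCompletion ℚ) φ) : GL (Fin 2) (padicCoeffIntegers S)) : Matrix (Fin 2) (Fin 2) (padicCoeffIntegers S)).trace ∈ Ideal.span {ϖ})
    (k : ℕ) :
    Nat.card (AddSubgroup.torsionBy (subgroupH1 (localSubgroup κ.kerSubgroup (v.adicCompletion ℚ)) (Cofree (ρ.toLocal v) (padicCoeffField S)))
        ((2 ^ k : ℕ) : ℤ)) =
      Nat.card (AddSubgroup.torsionBy (Cofree (ρ.toLocal v) (padicCoeffField S)) ((2 ^ k : ℕ) : ℤ)) := by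
  obtain ⟨h2, e, hpow⟩ := exists_two_mem_span_and_pow_smul_eq_zero S hϖ
  have hq := odd_residueFieldCard h2v
  refine natCard_torsionBy_subgroupH1_eq_of_frob_pow κ h2v hns hφ (exists_pow_smul_cofree_eq_zero S (ρ.toLocal v))
    (exists_two_nsmul_eq_cofree S ρ) (fun k ↦ Summit.BirchSwinnertonDyer.BirchSwinnertonDyer.Theorems.LambdaLowerBoundO.finite_torsionBy_cofree_pow S ρ k)
    (continuous_smul_cofree S ρ) (fun σ hσ ↦ smul_cofree_eq_of_apply_eq_one S ρ (hI σ hσ))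
    (fun k ↦ ⟨e * k, fun R hR a ha ↦ ?_⟩) (fun k ↦ ⟨e * k, fun R hR a ha ↦ ?_⟩) k
  · exact Cofree.pow_two_pow_smul_eq_self (padicCoeffField S) (ρ.toLocal v) ϖ h2 φ hdet htr (e * k) R hR a (hpow k a ha)
  · exact Cofree.pow_two_pow_smul_eq_nsmul (padicCoeffField S) (ρ.toLocal v) ϖ h2 φ hdet htr _ hq (e * k) R hR a (hpow k a ha)

/-- … **numerically: `#H¹(ℚ_{∞,w}, A_ρ)[2^k] = #(𝒪/2^k 𝒪)²`** (`natCard_torsionBy_cofree`), i.e. the block is `(F/𝒪)² ≅ (ℚ₂/ℤ₂)^{2f}` layer by layer.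
[cite: GreenbergVatsal2000, §2 Prop. (2.4)] [cite: Kato2004Asterisque, §13.8 (p. 228)] -/
theorem natCard_torsionBy_subgroupH1_cofree_eq_pow_of_trace_mem (h2v : ((2 : ℕ) : 𝓞 ℚ) ∉ v.asIdeal)
    (hns : ∃ σ : absoluteGaloisGroup (v.adicCompletion ℚ), σ ∉ localSubgroup κ.kerSubgroup (v.adicCompletion ℚ))
    {φ : absoluteGaloisGroup (v.adicCompletion ℚ)} (hφ : IsFrobPow φ 1)
    (hI : ∀ σ ∈ absInertia (v.adicCompletion ℚ), ρ (absGaloisRestrict ℚ (v.adicCompletion ℚ) σ) = 1)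
    {ϖ : padicCoeffIntegers S} (hϖ : Irreducible ϖ)
    (hdet : ((ρ (absGaloisRestrict ℚ (v.adicCompletion ℚ) φ) : GL (Fin 2) (padicCoeffIntegers S)) : Matrix (Fin 2) (Fin 2) (padicCoeffIntegers S)).det - 1 ∈ Ideal.span {ϖ})
    (htr : ((ρ (absGaloisRestrict ℚ (v.adicCompletion ℚ) φ) : GL (Fin 2) (padicCoeffIntegers S)) : Matrix (Fin 2) (Fin 2) (padicCoeffIntegers S)).trace ∈ Ideal.span {ϖ})
    (k : ℕ) :
    Nat.card (AddSubgroup.torsionBy (subgroupH1 (localSubgroup κ.kerSubgroup (v.adicCompletion ℚ)) (Cofree (ρ.toLocal v) (padicCoeffField S)))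
        ((2 ^ k : ℕ) : ℤ)) =
      Nat.card (padicCoeffIntegers S ⧸ Ideal.span {(2 : padicCoeffIntegers S) ^ k}) ^ 2 := by
  rw [natCard_torsionBy_subgroupH1_cofree_eq_of_trace_mem S ρ κ h2v hns hφ hI hϖ hdet htr k]
  exact Summit.BirchSwinnertonDyer.BirchSwinnertonDyer.Theorems.ThetaTransport.CofreeTorsionCount.natCard_torsionBy_cofree S ρ k

/-- **ODD trace ⟹ `H¹(ℚ_{∞,w}, A_ρ) = 0`.** Same setting with `tr ρ(φ) ∉ (ϖ)`: by `CofreeFrobeniusRigidity` the twisted fixed-point equation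
`φ^{2^R} b = q_v^{2^R} b` has no non-zero solution in `A_ρ[ϖ^∞] = A_ρ`, so §2's odd type applies: the local block VANISHES at a good place of odd trace.
[cite: GreenbergVatsal2000, §2 Prop. (2.4) and proof (arXiv p. 22)] [cite: GreenbergLNM1716, §3 Lemma 3.3] -/
theorem subgroupH1_cofree_eq_zero_of_trace_not_mem (h2v : ((2 : ℕ) : 𝓞 ℚ) ∉ v.asIdeal)
    (hns : ∃ σ : absoluteGaloisGroup (v.adicCompletion ℚ), σ ∉ localSubgroup κ.kerSubgroup (v.adicCompletion ℚ))
    {φ : absoluteGaloisGroup (v.adicCompletion ℚ)} (hφ : IsFrobPow φ 1)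
    (hI : ∀ σ ∈ absInertia (v.adicCompletion ℚ), ρ (absGaloisRestrict ℚ (v.adicCompletion ℚ) σ) = 1)
    {ϖ : padicCoeffIntegers S} (hϖ : Irreducible ϖ)
    (hdet : ((ρ (absGaloisRestrict ℚ (v.adicCompletion ℚ) φ) : GL (Fin 2) (padicCoeffIntegers S)) : Matrix (Fin 2) (Fin 2) (padicCoeffIntegers S)).det - 1 ∈ Ideal.span {ϖ})
    (htr : ((ρ (absGaloisRestrict ℚ (v.adicCompletion ℚ) φ) : GL (Fin 2) (padicCoeffIntegers S)) : Matrix (Fin 2) (Fin 2) (padicCoeffIntegers S)).trace ∉ Ideal.span {ϖ})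
    (c : subgroupH1 (localSubgroup κ.kerSubgroup (v.adicCompletion ℚ)) (Cofree (ρ.toLocal v) (padicCoeffField S))) : c = 0 := by
  obtain ⟨h2, e, hpow⟩ := exists_two_mem_span_and_pow_smul_eq_zero S hϖ
  have hq := odd_residueFieldCard h2v
  haveI := isPrincipalIdealRing_padicCoeffIntegers S
  have hmax : (Ideal.span {ϖ}).IsMaximal := PrincipalIdealRing.isMaximal_of_irreducible hϖ
  have hcoe : ∀ x : padicCoeffIntegers S,
      ((algebraMap (padicCoeffIntegers S) (padicCoeffField S) x : padicCoeffField S) : PadicAlgCl 2) = (x : PadicAlgCl 2) := fun _ ↦ rfl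
  have hinj : Function.Injective (algebraMap (padicCoeffIntegers S) (padicCoeffField S)) := fun x y h ↦
    Subtype.ext (by rw [← hcoe x, ← hcoe y, h])
  refine subgroupH1_eq_zero_of_frob_pow κ h2v hns hφ (exists_pow_smul_cofree_eq_zero S (ρ.toLocal v)) (exists_two_nsmul_eq_cofree S ρ)
    (fun k ↦ Summit.BirchSwinnertonDyer.BirchSwinnertonDyer.Theorems.LambdaLowerBoundO.finite_torsionBy_cofree_pow S ρ k) (continuous_smul_cofree S ρ)
    (fun σ hσ ↦ smul_cofree_eq_of_apply_eq_one S ρ (hI σ hσ)) (fun k ↦ ⟨0, fun R _ a ha hga ↦ ?_⟩) c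
  exact Cofree.eq_zero_of_pow_two_pow_smul_eq_nsmul (padicCoeffField S) (ρ.toLocal v) ϖ hmax h2 hinj hϖ.ne_zero φ hdet htr _ hq R a
    ⟨e * k, hpow k a ha⟩ hga

/-- **`H¹(ℚ_{∞,w}, A_ρ)` is `2`-DIVISIBLE** at every `v ∤ 2` not split completely (any trace): UTD's `exists_nsmul_eq_subgroupH1_localSubgroup` for the
`2`-primary, `2`-divisible, finite-layered, continuous `A_ρ`. With the even-trace count this is `H¹(ℚ_{∞,w}, A_ρ) ≅ (ℚ₂/ℤ₂)^{2f}` numerically.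
[cite: GreenbergVatsal2000, §2 Prop. (2.4) and proof (arXiv p. 22)] -/
theorem exists_two_nsmul_eq_subgroupH1_cofree (h2v : ((2 : ℕ) : 𝓞 ℚ) ∉ v.asIdeal)
    (hns : ∃ σ : absoluteGaloisGroup (v.adicCompletion ℚ), σ ∉ localSubgroup κ.kerSubgroup (v.adicCompletion ℚ))
    (c : subgroupH1 (localSubgroup κ.kerSubgroup (v.adicCompletion ℚ)) (Cofree (ρ.toLocal v) (padicCoeffField S))) :
    ∃ c' : subgroupH1 (localSubgroup κ.kerSubgroup (v.adicCompletion ℚ)) (Cofree (ρ.toLocal v) (padicCoeffField S)), 2 • c' = c :=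
  exists_nsmul_eq_subgroupH1_localSubgroup κ h2v hns (exists_pow_smul_cofree_eq_zero S (ρ.toLocal v)) (exists_two_nsmul_eq_cofree S ρ)
    (fun k ↦ by
      have hset : {a : Cofree (ρ.toLocal v) (padicCoeffField S) | 2 ^ k • a = 0} =
          ((AddSubgroup.torsionBy (Cofree (ρ.toLocal v) (padicCoeffField S)) ((2 ^ k : ℕ) : ℤ)) :
            Set (Cofree (ρ.toLocal v) (padicCoeffField S))) := by
        ext a
        rw [Set.mem_setOf_eq, SetLike.mem_coe, AddSubgroup.torsionBy.nsmul_iff]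
      rw [hset]
      haveI : Finite (AddSubgroup.torsionBy (Cofree (ρ.toLocal v) (padicCoeffField S)) ((2 ^ k : ℕ) : ℤ)) :=
        Summit.BirchSwinnertonDyer.BirchSwinnertonDyer.Theorems.LambdaLowerBoundO.finite_torsionBy_cofree_pow S ρ k
      exact Set.toFinite _)
    (continuous_smul_cofree S ρ) c

/-- **For the CYCLOTOMIC `ℤ₂`-extension no finite place splits completely** (`κ(res_v σ) ≠ 1` for some `σ ∈ Γ_{ℚ_v}`, the tree's
`Greenberg1999.exists_apply_resGal_ne_one_of_isCyclotomic`): the hypothesis `hns` of this file at every `v`. [cite: GreenbergLNM1716, §1] -/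
theorem exists_not_mem_localSubgroup_of_isCyclotomic (hκ : κ.IsCyclotomic) (v : HeightOneSpectrum (𝓞 ℚ)) :
    ∃ σ : absoluteGaloisGroup (v.adicCompletion ℚ), σ ∉ localSubgroup κ.kerSubgroup (v.adicCompletion ℚ) := by
  obtain ⟨σ, hσ⟩ := Greenberg1999.exists_apply_resGal_ne_one_of_isCyclotomic hκ v
  exact ⟨σ, fun h ↦ hσ ((mem_localSubgroup_iff κ.kerSubgroup (v.adicCompletion ℚ) σ).mp h)⟩

end Cofree

end Summit.BirchSwinnertonDyer.BirchSwinnertonDyer.Theorems.ThetaTransport.LocalBlockCount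

end
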